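import Literature.AlgebraicGeometry.Resolution.DiffOpOver
import Mathlib.RingTheory.Smooth.Basic
import Mathlib.RingTheory.TensorProduct.Maps
import Mathlib.LinearAlgebra.Quotient.Basic
import Mathlib.RingTheory.Ideal.Quotient.Operations
import Mathlib.RingTheory.Ideal.Maps
import HarnessLib

/-!
# Differential operators extend along formally smooth algebras (EGA IV₄ §16 via infinitesimal lifting)

Topic `Literature/AlgebraicGeometry/Resolution`; companion of `DifferentialOperators.lean` (Grothendieck's differential
operators `IsDiffOpLE R n D` of an `R`-algebra, EGA IV₄ Prop. 16.8.8 (b) taken as the definition), `DiffOpOver.lean`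
(operators `T : A → B` into an `A`-algebra, `IsDiffOpOver R n T`) and `DiffOpPrincipalParts.lean` (16.8.8 (a)⇔(b):
`D` has order `≤ n` iff `a ⊗ t ↦ a · D t` kills `ℑ^{n+1}`, `ℑ = ker (A ⊗_R A → A)`).

**Theorem** (`IsDiffOpOver.exists_extend`, `IsDiffOpLE.exists_extend_of_formallySmooth`). Let `R → A → B` be
commutative rings with `B` FORMALLY SMOOTH over `A` (Mathlib `Algebra.FormallySmooth A B`; e.g. `B` étale over `A`, a
localisation, a polynomial algebra). Then every `R`-linear differential operator `T : A → B` of order `≤ n` over the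
structure map `φ` — in particular `φ ∘ D` for every differential operator `D : A → A` of order `≤ n` — is the
restriction of a differential operator `D' : B → B` of order `≤ n`: `D' ∘ φ = T`. Consequently
`Diff^{≤ n}_{A/R}(I) · B ⊆ Diff^{≤ n}_{B/R}(I · B)` for every ideal `I ⊆ A` (`algebraMap_mem_diffIdeal_of_formallySmooth`, membership form; the localisation cases are `map_diffIdeal_le_away` / `diffIdeal_le_comap_diffIdeal_map` of `DiffOpLocalizationExtend.lean` / `DiffIdealLocalizationGeneral.lean`).

Proof (the infinitesimal-lifting argument of EGA IV₄ Déf. 17.1.1, cf. Prop. 17.2.3 / Cor. 17.2.4 for the order-one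
case, written in the commutator formalism of the tree — no module of principal parts of `B` is needed). Let
`𝔍 = ker (μ : A ⊗_R B → B, a ⊗ b ↦ φ(a) b)` (`relIdeal`), spanned by the `a ⊗ 1 − 1 ⊗ φ(a)` (`relIdeal_eq_span`), and
`Λ_T : A ⊗_R B → B`, `a ⊗ b ↦ T(a) b` (`tensorEval`). (1) `Λ_T(x · (a ⊗ 1 − 1 ⊗ φ a)) = Λ_{[T,a]}(x)`, hence by
induction on the order `T` has order `≤ n` iff `Λ_T` kills `𝔍^{n+1}` (`isDiffOpOver_iff_kills`; for `B = A` this is the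
tree's `EGA4_16_8.isDiffOpLE_iff_kills`). (2) `C = (A ⊗_R B)/𝔍^{n+1}` is an `A`-algebra through the left factor, its
augmentation `π : C → B` (induced by `μ`) is surjective with nilpotent kernel `𝔍̄ = 𝔍/𝔍^{n+1}`, so by formal
smoothness the identity of `B` lifts to an `A`-ALGEBRA map `δ : B → C` with `π ∘ δ = id` (Mathlib
`Algebra.FormallySmooth.liftOfSurjective`); being an `A`-algebra map, `δ(φ a) = cls(a ⊗ 1)`. (3) Put
`D' = Λ̄_T ∘ δ`, `Λ̄_T : C → B` the map induced by (1). Then `D'(φ a) = Λ_T(a ⊗ 1) = T(a)`, and for `c ∈ C` the maps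
`T_c : y ↦ Λ̄_T(c · δ y)` satisfy `[T_c, b] = T_{c · (δ b − ι b)}` with `ι b = cls(1 ⊗ b)` and `δ b − ι b ∈ 𝔍̄`
(both lift `b`); as `𝔍̄^{n+1} = 0`, `c ∈ 𝔍̄^{j}` gives `T_c` order `≤ n − j`, and `D' = T_1` has order `≤ n`.

Uniqueness of `D'` (which holds when `B` is formally ÉTALE over `A`) is not proved here.

Motivation (cell `res-hironaka`, HIRONAKA-L lane; nothing about any manuscript is asserted here): extracting a unit from
an element of order `m` by a differential operator of order `≤ m` at a closed point of a SMOOTH scheme over a perfect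
field (Hironaka 2017 p.27 l.24, typed `Hironaka2017.S05NegativePart.U27L24`) reduces by this theorem (étale coordinates)
and by «`Diff` commutes with localisation» (`DiffIdealLocalizationGeneral.lean`) to the polynomial ring, where the
Hasse–Schmidt derivatives do it (`TaylorUnitOrderCriterion.lean`, `HasseSchmidtDerivatives.lean`).

Sources: [EGAIV4] §16.8 ((16.8.2), Prop. (16.8.8) p.42–43: the vanishing-on-`ℑ^{n+1}` criterion), (0_IV, 20.4.4)
(generators of the diagonal ideal), §17.1 Déf. (17.1.1) (formally smooth = infinitesimal lifting along nilpotent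
ideals), Prop. (17.2.3)–Cor. (17.2.4) (the order-one case: `Ω` along formally smooth / étale morphisms; the tree's
`DerivativeIdealsEtale.lean` proves the derivation case separately). The all-orders statement is proved here by the
lifting argument; no item of [EGAIV4] is quoted for it verbatim. -- TODO(general form): uniqueness for formally
étale `B/A` and `Diff^n_{B/R} = B ⊗_A Diff^n_{A/R}` for `A/R` smooth.
-/

noncomputable section

namespace Literature.AlgebraicGeometry.Resolution

open scoped TensorProduct

universe u v w

section RelIdeal

variable (R : Type u) (A : Type v) (B : Type w) [CommRing R] [CommRing A] [CommRing B] [Algebra R A] [Algebra R B]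
  [Algebra A B] [IsScalarTower R A B]

/-- The multiplication map `μ : A ⊗_R B → B`, `a ⊗ b ↦ φ(a) · b`, as an `A`-algebra map for the LEFT `A`-structure of
`A ⊗_R B` (`φ : A → B` the structure map; for `B = A` Mathlib's `TensorProduct.lmul'`).
[cite: EGAIV4, (16.8.2) p.40 and (0, 20.4.4) (the diagonal ideal and its generators)] -/
def relMul : A ⊗[R] B →ₐ[A] B :=
  Algebra.TensorProduct.lift (Algebra.ofId A B) (AlgHom.id R B) fun _ _ => Commute.all _ _

/-- `μ(a ⊗ b) = φ(a) · b`. [cite: EGAIV4, (16.8.2) p.40] -/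
@[simp] theorem relMul_tmul (a : A) (b : B) : relMul R A B (a ⊗ₜ[R] b) = algebraMap A B a * b := by
  simp [relMul]

/-- The RELATIVE diagonal ideal `𝔍 = ker (A ⊗_R B → B)`; for `B = A` this is Mathlib's `KaehlerDifferential.ideal R A`.
[cite: EGAIV4, (0, 20.4.4) and (16.8.2) p.40 (the diagonal ideal; here relative to φ : A → B)] -/
def relIdeal : Ideal (A ⊗[R] B) :=
  RingHom.ker (relMul R A B).toRingHom

variable {A B}

/-- Membership in `𝔍` is vanishing under `μ`. [cite: EGAIV4, (0, 20.4.4) and (16.8.2) p.40] -/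
theorem mem_relIdeal_iff (x : A ⊗[R] B) : x ∈ relIdeal R A B ↔ relMul R A B x = 0 := Iff.rfl

/-- The generators `a ⊗ 1 − 1 ⊗ φ(a)` lie in `𝔍`. [cite: EGAIV4, (0, 20.4.4) (generators of the diagonal ideal)] -/
theorem tmul_one_sub_one_tmul_mem_relIdeal (a : A) :
    a ⊗ₜ[R] (1 : B) - (1 : A) ⊗ₜ[R] algebraMap A B a ∈ relIdeal R A B := by
  rw [mem_relIdeal_iff, map_sub, relMul_tmul, relMul_tmul, map_one, mul_one, one_mul, sub_self]

/-- `x − 1 ⊗ μ(x)` lies in the ideal spanned by the `a ⊗ 1 − 1 ⊗ φ(a)`. [cite: EGAIV4, (0, 20.4.4)] -/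
private theorem sub_one_tmul_relMul_mem_span (x : A ⊗[R] B) :
    x - (1 : A) ⊗ₜ[R] relMul R A B x ∈
      Ideal.span (Set.range fun a : A => a ⊗ₜ[R] (1 : B) - (1 : A) ⊗ₜ[R] algebraMap A B a) := by
  induction x using TensorProduct.induction_on with
  | zero => simp
  | tmul a b =>
      have h : a ⊗ₜ[R] b - (1 : A) ⊗ₜ[R] relMul R A B (a ⊗ₜ[R] b) =
          (a ⊗ₜ[R] (1 : B) - (1 : A) ⊗ₜ[R] algebraMap A B a) * ((1 : A) ⊗ₜ[R] b) := by
        rw [relMul_tmul, sub_mul, Algebra.TensorProduct.tmul_mul_tmul, Algebra.TensorProduct.tmul_mul_tmul,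
          mul_one, one_mul, one_mul]
      rw [h]
      exact Ideal.mul_mem_right _ _ (Ideal.subset_span ⟨a, rfl⟩)
  | add x y hx hy =>
      have h : x + y - (1 : A) ⊗ₜ[R] relMul R A B (x + y) =
          (x - (1 : A) ⊗ₜ[R] relMul R A B x) + (y - (1 : A) ⊗ₜ[R] relMul R A B y) := by
        rw [map_add, TensorProduct.tmul_add]; abel
      rw [h]
      exact Ideal.add_mem _ hx hy

/-- **`𝔍` is spanned by the `a ⊗ 1 − 1 ⊗ φ(a)`** (for `B = A`: Mathlib `KaehlerDifferential.span_range_eq_ideal`).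
[cite: EGAIV4, (0, 20.4.4)] -/
theorem relIdeal_eq_span :
    relIdeal R A B = Ideal.span (Set.range fun a : A => a ⊗ₜ[R] (1 : B) - (1 : A) ⊗ₜ[R] algebraMap A B a) := by
  refine le_antisymm (fun x hx => ?_) (Ideal.span_le.mpr ?_)
  · have h := sub_one_tmul_relMul_mem_span R x
    rwa [(mem_relIdeal_iff R x).mp hx, TensorProduct.tmul_zero, sub_zero] at h
  · rintro _ ⟨a, rfl⟩
    exact tmul_one_sub_one_tmul_mem_relIdeal R a

end RelIdeal

section Eval

variable (R : Type u) {A : Type v} {B : Type w} [CommRing R] [CommRing A] [CommRing B] [Algebra R A] [Algebra R B]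

/-- `Λ_T : A ⊗_R B → B`, `a ⊗ b ↦ T(a) · b`, for an `R`-linear `T : A → B` (EGA's `D'` of (16.8.2) «`D'(b ⊗ t) = b D(t)`»,
here for operators `A → B` and with `B` acting on the right factor). [cite: EGAIV4, (16.8.2) p.40] -/
def tensorEval (T : A →ₗ[R] B) : A ⊗[R] B →ₗ[R] B :=
  TensorProduct.lift ((LinearMap.mul R B).comp T)

/-- `Λ_T(a ⊗ b) = T(a) · b`. [cite: EGAIV4, (16.8.2) p.40] -/
@[simp] theorem tensorEval_tmul (T : A →ₗ[R] B) (a : A) (b : B) : tensorEval R T (a ⊗ₜ[R] b) = T a * b := by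
  simp [tensorEval]

/-- `Λ_0 = 0`. [cite: EGAIV4, (16.8.2) p.40] -/
@[simp] theorem tensorEval_zero : tensorEval R (0 : A →ₗ[R] B) = 0 :=
  TensorProduct.ext' fun a b => by simp

/-- `Λ_T` is linear for the right `B`-structure: `Λ_T((1 ⊗ b) · x) = b · Λ_T(x)`. [cite: EGAIV4, (16.8.2) p.40] -/
theorem tensorEval_one_tmul_mul (T : A →ₗ[R] B) (b : B) (x : A ⊗[R] B) :
    tensorEval R T (((1 : A) ⊗ₜ[R] b) * x) = b * tensorEval R T x := by
  induction x using TensorProduct.induction_on with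
  | zero => simp
  | tmul a c => rw [Algebra.TensorProduct.tmul_mul_tmul, one_mul, tensorEval_tmul, tensorEval_tmul]; ring
  | add x y hx hy => rw [mul_add, map_add, map_add, hx, hy, mul_add]

/-- `Λ_T(x · (a ⊗ 1)) = Λ_{T ∘ (a·)}(x)`. [cite: EGAIV4, Prop. 16.8.8 (proof, p.43)] -/
theorem tensorEval_mul_tmul_one (T : A →ₗ[R] B) (a : A) (x : A ⊗[R] B) :
    tensorEval R T (x * (a ⊗ₜ[R] (1 : B))) = tensorEval R (T ∘ₗ LinearMap.mulLeft R a) x := by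
  induction x using TensorProduct.induction_on with
  | zero => simp
  | tmul a' c =>
      rw [Algebra.TensorProduct.tmul_mul_tmul, mul_one, tensorEval_tmul, tensorEval_tmul, LinearMap.comp_apply,
        LinearMap.mulLeft_apply, mul_comm a' a]
  | add x y hx hy => rw [add_mul, map_add, map_add, hx, hy]

variable [Algebra A B]

/-- **`Λ_T` of a generator of `𝔍` is `Λ` of the commutator**: `Λ_T(x · (a ⊗ 1 − 1 ⊗ φ a)) = Λ_{[T,a]}(x)`.
[cite: EGAIV4, Prop. 16.8.8 (proof, p.43)] -/
theorem tensorEval_mul_gen (T : A →ₗ[R] B) (a : A) (x : A ⊗[R] B) :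
    tensorEval R T (x * (a ⊗ₜ[R] (1 : B) - (1 : A) ⊗ₜ[R] algebraMap A B a)) = tensorEval R (commOver R T a) x := by
  induction x using TensorProduct.induction_on with
  | zero => simp
  | tmul a' c =>
      simp only [mul_sub, map_sub, Algebra.TensorProduct.tmul_mul_tmul, mul_one, tensorEval_tmul,
        commOver_apply, mul_comm a' a]
      ring
  | add x y hx hy => rw [add_mul, map_add, hx, hy, map_add]

variable [IsScalarTower R A B]

/-- `Λ_T` kills `𝔍^0 = (1)` iff `T = 0`. [cite: EGAIV4, Prop. 16.8.8 (proof, p.43)] -/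
private theorem kills_zero_iff (T : A →ₗ[R] B) :
    (∀ x ∈ relIdeal R A B ^ 0, tensorEval R T x = 0) ↔ T = 0 := by
  constructor
  · intro h
    ext a
    have := h (a ⊗ₜ[R] (1 : B)) (by rw [pow_zero, Ideal.one_eq_top]; exact Submodule.mem_top)
    rwa [tensorEval_tmul, mul_one] at this
  · rintro rfl x _
    rw [tensorEval_zero, LinearMap.zero_apply]

/-- The inductive step: `Λ_T` kills `𝔍^{m+1}` iff every `Λ_{[T,a]}` kills `𝔍^m`. [cite: EGAIV4, Prop. 16.8.8 (proof, p.43)] -/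
private theorem kills_succ_iff (m : ℕ) (T : A →ₗ[R] B) :
    (∀ x ∈ relIdeal R A B ^ (m + 1), tensorEval R T x = 0) ↔
      ∀ a : A, ∀ x ∈ relIdeal R A B ^ m, tensorEval R (commOver R T a) x = 0 := by
  constructor
  · intro h a x hx
    rw [← tensorEval_mul_gen]
    refine h _ ?_
    rw [pow_succ]
    exact Ideal.mul_mem_mul hx (tmul_one_sub_one_tmul_mem_relIdeal R a)
  · intro h x hx
    rw [pow_succ] at hx
    refine Submodule.mul_induction_on hx (fun y hy z hz => ?_) (fun x₁ x₂ h₁ h₂ => ?_)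
    · revert y
      rw [relIdeal_eq_span] at hz
      refine Submodule.span_induction (p := fun z _ => ∀ y ∈ relIdeal R A B ^ m, tensorEval R T (y * z) = 0)
        ?_ ?_ ?_ ?_ hz
      · rintro _ ⟨a, rfl⟩ y hy
        rw [tensorEval_mul_gen]
        exact h a y hy
      · intro y _; rw [mul_zero, map_zero]
      · intro z₁ z₂ _ _ h₁ h₂ y hy
        rw [mul_add, map_add, h₁ y hy, h₂ y hy, add_zero]
      · intro w z _ hz' y hy
        rw [smul_eq_mul, ← mul_assoc]
        exact hz' (y * w) (Ideal.mul_mem_right w _ hy)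
    · rw [map_add, h₁, h₂, add_zero]

/-- **Order `≤ n` over `φ` ⇔ `Λ_T` kills `𝔍^{n+1}`** (the relative form of EGA IV₄ 16.8.8 (b)⇔(c); for `B = A` it is
the tree's `EGA4_16_8.isDiffOpLE_iff_kills`). [cite: EGAIV4, Prop. 16.8.8 p.42–43] -/
theorem isDiffOpOver_iff_kills :
    ∀ (n : ℕ) (T : A →ₗ[R] B),
      IsDiffOpOver R n T ↔ ∀ x ∈ relIdeal R A B ^ (n + 1), tensorEval R T x = 0
  | 0, T => by
    rw [kills_succ_iff]
    exact forall_congr' fun a => (kills_zero_iff R _).symm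
  | n + 1, T => by
    rw [kills_succ_iff]
    exact forall_congr' fun a => isDiffOpOver_iff_kills n _

end Eval

/-! ## The extension -/

section Extend

variable (R : Type u) {A : Type v} {B : Type w} [CommRing R] [CommRing A] [CommRing B] [Algebra R A] [Algebra R B]
  [Algebra A B] [IsScalarTower R A B]

/-- `algebraLinearMap R A B a = φ(a)` (plumbing; the tree's copy in `DiffOpOver.lean` is private). [folklore] -/
private theorem algebraLinearMap_apply' (a : A) : algebraLinearMap R A B a = algebraMap A B a := rfl

/-- The `n`-th infinitesimal neighbourhood `C = (A ⊗_R B)/𝔍^{n+1}` of the graph; an `A`-algebra through the left factor.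
[cite: EGAIV4, Déf. 16.1.2 (infinitesimal neighbourhoods)] -/
private abbrev Nbhd (n : ℕ) : Type (max v w) := (A ⊗[R] B) ⧸ relIdeal R A B ^ (n + 1)

/-- The augmentation `π : C → B` induced by `μ`. [cite: EGAIV4, Déf. 16.1.2] -/
private def aug (n : ℕ) : Nbhd R (A := A) (B := B) n →ₐ[A] B :=
  Ideal.Quotient.liftₐ (relIdeal R A B ^ (n + 1)) (relMul R A B) fun x hx =>
    (mem_relIdeal_iff R x).mp (Ideal.pow_le_self (Nat.succ_ne_zero n) hx)

/-- `π(cls x) = μ(x)`. [folklore] -/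
private theorem aug_mk (n : ℕ) (x : A ⊗[R] B) :
    aug R n (Ideal.Quotient.mk (relIdeal R A B ^ (n + 1)) x) = relMul R A B x := rfl

/-- `π` is surjective (`π(cls(1 ⊗ b)) = b`). [folklore] -/
private theorem aug_surjective (n : ℕ) : Function.Surjective (aug R (A := A) (B := B) n) := fun b =>
  ⟨Ideal.Quotient.mk _ ((1 : A) ⊗ₜ[R] b), by rw [aug_mk, relMul_tmul, map_one, one_mul]⟩

/-- `𝔍̄ = 𝔍/𝔍^{n+1} ⊆ C`. [cite: EGAIV4, Déf. 16.1.2 (infinitesimal neighbourhoods)] -/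
private abbrev relIdealBar (n : ℕ) : Ideal (Nbhd R (A := A) (B := B) n) :=
  (relIdeal R A B).map (Ideal.Quotient.mk (relIdeal R A B ^ (n + 1)))

/-- `ker π ≤ 𝔍̄ = 𝔍/𝔍^{n+1}`. [cite: EGAIV4, Déf. 16.1.2] -/
private theorem ker_aug_le (n : ℕ) :
    RingHom.ker (aug R (A := A) (B := B) n) ≤ relIdealBar R (A := A) (B := B) n := by
  intro z hz
  obtain ⟨x, rfl⟩ := Ideal.Quotient.mk_surjective z
  exact Ideal.mem_map_of_mem _ ((mem_relIdeal_iff R x).mpr hz)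

/-- `𝔍̄^{n+1} = 0`. [cite: EGAIV4, Déf. 16.1.2] -/
private theorem map_relIdeal_pow_eq_bot (n : ℕ) : relIdealBar R (A := A) (B := B) n ^ (n + 1) = ⊥ := by
  rw [relIdealBar, ← Ideal.map_pow, Ideal.map_quotient_self]

/-- `ker π` is nilpotent. [folklore] -/
private theorem isNilpotent_ker_aug (n : ℕ) :
    IsNilpotent (RingHom.ker (aug R (A := A) (B := B) n : Nbhd R (A := A) (B := B) n →+* B)) := by
  rw [RingHom.ker_coe_toRingHom]
  exact ⟨n + 1, le_bot_iff.mp ((Ideal.pow_right_mono (ker_aug_le R n) (n + 1)).trans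
    (map_relIdeal_pow_eq_bot R n).le)⟩

/-- `𝔍^{n+1} ⊆ ker Λ_T` as `R`-submodules. [folklore] -/
private theorem kills_le_ker (n : ℕ) (T : A →ₗ[R] B) (hT : ∀ x ∈ relIdeal R A B ^ (n + 1), tensorEval R T x = 0) :
    (relIdeal R A B ^ (n + 1)).restrictScalars R ≤ LinearMap.ker (tensorEval R T) := fun x hx =>
  LinearMap.mem_ker.mpr (hT x hx)

/-- `Λ̄_T : C → B`, the map induced by `Λ_T` when `Λ_T` kills `𝔍^{n+1}`. [cite: EGAIV4, (16.8.2) p.40] -/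
private def evalQ (n : ℕ) (T : A →ₗ[R] B) (hT : ∀ x ∈ relIdeal R A B ^ (n + 1), tensorEval R T x = 0) :
    Nbhd R (A := A) (B := B) n →ₗ[R] B :=
  ((relIdeal R A B ^ (n + 1)).restrictScalars R).liftQ (tensorEval R T) (kills_le_ker R n T hT) ∘ₗ
    (Submodule.Quotient.restrictScalarsEquiv R (relIdeal R A B ^ (n + 1))).symm.toLinearMap

/-- `Λ̄_T(cls x) = Λ_T(x)`. [folklore] -/
private theorem evalQ_mk (n : ℕ) (T : A →ₗ[R] B) (hT) (x : A ⊗[R] B) :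
    evalQ R n T hT (Ideal.Quotient.mk (relIdeal R A B ^ (n + 1)) x) = tensorEval R T x := by
  change ((relIdeal R A B ^ (n + 1)).restrictScalars R).liftQ (tensorEval R T) (kills_le_ker R n T hT)
    ((Submodule.Quotient.restrictScalarsEquiv R (relIdeal R A B ^ (n + 1))).symm (Submodule.Quotient.mk x)) = _
  rw [Submodule.Quotient.restrictScalarsEquiv_symm_mk, Submodule.liftQ_apply]

/-- `Λ̄_T(ι(b) · z) = b · Λ̄_T(z)`, `ι(b) = cls(1 ⊗ b)`. [cite: EGAIV4, (16.8.2) p.40] -/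
private theorem evalQ_iota_mul (n : ℕ) (T : A →ₗ[R] B) (hT) (b : B) (z : Nbhd R (A := A) (B := B) n) :
    evalQ R n T hT (Ideal.Quotient.mk _ ((1 : A) ⊗ₜ[R] b) * z) = b * evalQ R n T hT z := by
  obtain ⟨x, rfl⟩ := Ideal.Quotient.mk_surjective z
  rw [← map_mul, evalQ_mk, evalQ_mk, tensorEval_one_tmul_mul]

variable [Algebra.FormallySmooth A B]

/-- The lift `δ : B → C` of the identity through `π` (formal smoothness of `B` over `A`), an `A`-ALGEBRA map.
[cite: EGAIV4, Déf. 17.1.1 (formally smooth: infinitesimal lifting)] -/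
private def delta (n : ℕ) : B →ₐ[A] Nbhd R (A := A) (B := B) n :=
  Algebra.FormallySmooth.liftOfSurjective (R := A) (A := B) (AlgHom.id A B) (aug R n) (aug_surjective R n)
    (isNilpotent_ker_aug R n)

/-- `π ∘ δ = id`. [folklore] -/
private theorem aug_delta (n : ℕ) (b : B) : aug R (A := A) n (delta R n b) = b := by
  have h := @Algebra.FormallySmooth.comp_liftOfSurjective A B _ _ _ (Nbhd R (A := A) (B := B) n) _ _ B _ _ _
    (AlgHom.id A B) (aug R n) (aug_surjective R n) (isNilpotent_ker_aug R n)
  exact AlgHom.congr_fun h b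

/-- `δ(b) − ι(b) ∈ 𝔍̄` (both lift `b`). [cite: EGAIV4, Déf. 17.1.1] -/
private theorem delta_sub_iota_mem (n : ℕ) (b : B) :
    delta R n b - Ideal.Quotient.mk _ ((1 : A) ⊗ₜ[R] b) ∈ relIdealBar R (A := A) (B := B) n := by
  refine ker_aug_le R n ?_
  rw [RingHom.mem_ker, map_sub, aug_delta, aug_mk, relMul_tmul, map_one, one_mul, sub_self]

/-- The operators `T_c : y ↦ Λ̄_T(c · δ y)`, `c ∈ C`. [cite: EGAIV4, Prop. 16.8.8 (proof)] -/
private def opOf (n : ℕ) (T : A →ₗ[R] B) (hT : ∀ x ∈ relIdeal R A B ^ (n + 1), tensorEval R T x = 0)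
    (c : Nbhd R (A := A) (B := B) n) : B →ₗ[R] B :=
  evalQ R n T hT ∘ₗ (LinearMap.mulLeft R c) ∘ₗ (delta R n).toLinearMap.restrictScalars R

/-- `T_c(y) = Λ̄_T(c · δ y)`. [folklore] -/
private theorem opOf_apply (n : ℕ) (T : A →ₗ[R] B) (hT) (c : Nbhd R (A := A) (B := B) n) (y : B) :
    opOf R n T hT c y = evalQ R n T hT (c * delta R n y) := rfl

/-- `T_0 = 0`. [folklore] -/
private theorem opOf_zero (n : ℕ) (T : A →ₗ[R] B) (hT) : opOf R n T hT (0 : Nbhd R (A := A) (B := B) n) = 0 := by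
  ext y; rw [opOf_apply, zero_mul, map_zero, LinearMap.zero_apply]

/-- **`[T_c, b] = T_{c · (δ b − ι b)}`**. [cite: EGAIV4, Prop. 16.8.8 (proof)] -/
private theorem commMul_opOf (n : ℕ) (T : A →ₗ[R] B) (hT) (c : Nbhd R (A := A) (B := B) n) (b : B) :
    commMul R (opOf R n T hT c) b = opOf R n T hT (c * (delta R n b - Ideal.Quotient.mk _ ((1 : A) ⊗ₜ[R] b))) := by
  ext y
  simp only [commMul_apply, opOf_apply, map_mul (delta R n)]
  rw [← evalQ_iota_mul, ← map_sub]
  congr 1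
  ring

/-- `c ∈ 𝔍̄^j`, `j + k = n` ⇒ `T_c` has order `≤ k`. [cite: EGAIV4, Prop. 16.8.8 (proof)] -/
private theorem isDiffOpLE_opOf (n : ℕ) (T : A →ₗ[R] B) (hT) :
    ∀ (k j : ℕ), j + k = n → ∀ c ∈ relIdealBar R (A := A) (B := B) n ^ j, IsDiffOpLE R k (opOf R n T hT c)
  | 0, j, hj, c, hc => by
    rw [isDiffOpLE_zero_iff]
    intro b
    rw [commMul_opOf]
    have hmem : c * (delta R n b - Ideal.Quotient.mk _ ((1 : A) ⊗ₜ[R] b)) ∈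
        relIdealBar R (A := A) (B := B) n ^ (j + 1) := by
      rw [pow_succ (relIdealBar R (A := A) (B := B) n) j]
      exact Ideal.mul_mem_mul hc (delta_sub_iota_mem R n b)
    have hj' : j + 1 = n + 1 := by omega
    rw [hj', map_relIdeal_pow_eq_bot, Ideal.mem_bot] at hmem
    rw [hmem, opOf_zero]
  | k + 1, j, hj, c, hc => by
    rw [isDiffOpLE_succ_iff]
    intro b
    rw [commMul_opOf]
    refine isDiffOpLE_opOf n T hT k (j + 1) (by omega) _ ?_
    rw [pow_succ (relIdealBar R (A := A) (B := B) n) j]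
    exact Ideal.mul_mem_mul hc (delta_sub_iota_mem R n b)

/-- **Differential operators over `φ` extend along formally smooth algebras.** For `B` formally smooth over `A` and an
`R`-linear `T : A → B` of order `≤ n` over the structure map `φ : A → B` (`IsDiffOpOver R n T`), there is a differential
operator `D' : B → B` of order `≤ n` over `R` with `D' ∘ φ = T`.
[cite: EGAIV4, Déf. (17.1.1) and Prop. (17.2.3)–Cor. (17.2.4) (formal smoothness; the order-one case), Prop. (16.8.8) p.42–43] -/
theorem IsDiffOpOver.exists_extend {n : ℕ} {T : A →ₗ[R] B} (hT : IsDiffOpOver R n T) :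
    ∃ D' : B →ₗ[R] B, IsDiffOpLE R n D' ∧ ∀ a : A, D' (algebraMap A B a) = T a := by
  have hK := (isDiffOpOver_iff_kills R n T).mp hT
  refine ⟨opOf R n T hK 1, isDiffOpLE_opOf R n T hK n 0 (zero_add n) 1 ?_, fun a => ?_⟩
  · rw [pow_zero (relIdealBar R (A := A) (B := B) n), Ideal.one_eq_top]
    exact Submodule.mem_top
  · rw [opOf_apply, one_mul, AlgHom.commutes, ← Ideal.Quotient.mk_algebraMap, Algebra.TensorProduct.algebraMap_apply,
      Algebra.algebraMap_self, RingHom.id_apply, evalQ_mk, tensorEval_tmul, mul_one]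

/-- **Differential operators extend along formally smooth algebras** (the case `T = φ ∘ D`): for `B` formally smooth
over `A`, every differential operator `D : A → A` of order `≤ n` over `R` is the restriction of a differential operator
`D' : B → B` of order `≤ n`: `D'(φ a) = φ(D a)`. In particular this holds for `B` étale over `A`, for localisations
(cf. `DiffOpLocalization.lean`, which gives an explicit extension) and for polynomial algebras.
[cite: EGAIV4, Déf. (17.1.1), Prop. (17.2.3)–Cor. (17.2.4), Prop. (16.8.8) p.42–43] -/
theorem IsDiffOpLE.exists_extend_of_formallySmooth {n : ℕ} {D : A →ₗ[R] A} (hD : IsDiffOpLE R n D) :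
    ∃ D' : B →ₗ[R] B, IsDiffOpLE R n D' ∧ D' ∘ₗ algebraLinearMap R A B = algebraLinearMap R A B ∘ₗ D := by
  obtain ⟨D', hD', h⟩ := (hD.isDiffOpOver_comp (B := B)).exists_extend R
  exact ⟨D', hD', LinearMap.ext fun a => h a⟩

/-- **`φ(Diff^{≤ n}_{A/R}(I)) ⊆ Diff^{≤ n}_{B/R}(I · B)`** (membership form; equivalently `Diff^{≤ n}(I) · B ⊆
Diff^{≤ n}(I · B)`) for `B` formally smooth over `A` and every ideal `I ⊆ A`; the localisation cases are
`map_diffIdeal_le_away` (`DiffOpLocalizationExtend.lean`) and `diffIdeal_le_comap_diffIdeal_map`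
(`DiffIdealLocalizationGeneral.lean`), localisations being formally étale.
[cite: EGAIV4, Déf. (17.1.1), Prop. (17.2.3)–Cor. (17.2.4), Prop. (16.8.8) p.42–43] -/
theorem algebraMap_mem_diffIdeal_of_formallySmooth {n : ℕ} {I : Ideal A} {x : A} (hx : x ∈ diffIdeal R n I) :
    algebraMap A B x ∈ diffIdeal R n (I.map (algebraMap A B)) := by
  have key : diffIdeal R n I ≤ (diffIdeal R n (I.map (algebraMap A B))).comap (algebraMap A B) := by
    rw [diffIdeal_le_iff]
    intro D hD y hy
    obtain ⟨D', hD', hD'y⟩ := (hD.isDiffOpOver_comp (B := B)).exists_extend R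
    rw [Ideal.mem_comap, ← algebraLinearMap_apply' R, ← LinearMap.comp_apply, ← hD'y]
    exact apply_mem_diffIdeal R hD' (Ideal.mem_map_of_mem _ hy)
  exact key hx

end Extend

end Literature.AlgebraicGeometry.Resolution

end
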